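import Mathlib.RingTheory.UniqueFactorizationDomain.NormalizedFactors
import Mathlib.RingTheory.UniqueFactorizationDomain.GCDMonoid
import Mathlib.Algebra.GCDMonoid.Finset
import Mathlib.Data.Matrix.Basic
import Mathlib.Tactic.LinearCombination
import Mathlib.Tactic.Ring

/-!
# Crux `RankOneTrivialisation` (stmt-ValiantsHypothesis-5667), line `nagata-multilinear-chart` —
stub 2 `stub_ufdOuterProduct`: over a UFD a rank-one matrix is an outer product

The step of the line that consumes FACTORIALITY (the closed crux 5666,
`Summit.ValiantsHypothesis.Theorems.permQuot_isDomain_and_ufm`: `S_n = ℂ[x_{n×n}]/(per_n)` is a UFD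
for `n ≥ 3`): if all `2 × 2` minors of a square matrix `B` over a UFD `R` vanish, then
`B i j = c i * w j` for some vectors `c, w : Fin m → R`.

Proof (gcd extraction of a non-zero column).  If `B = 0` take `c = w = 0`.  Otherwise pick an entry
`B k j₀ ≠ 0`, let `g` be the gcd of column `j₀` and write `B i j₀ = g * c i` with `c` primitive
(`Finset.extract_gcd`: the gcd of the `c i` is `1`).  The minor relations with rows `i, k` and
columns `j, j₀` give, after cancelling `g ≠ 0`, `c k * B i j = B k j * c i` for all `i, j`.  Hence
`c k ∣ B k j * c i` for every `i`, so `c k` divides `gcd_i (B k j * c i) = normalize (B k j) * gcd_i (c i)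
= normalize (B k j)` (`Finset.gcd_mul_left`), i.e. `c k ∣ B k j`; write `B k j = c k * w j`.  Then
`c k * B i j = c k * w j * c i` and cancelling `c k ≠ 0` gives `B i j = c i * w j`.

FALSE over non-factorial domains (Disproof.lean of the crux, witness `A₂`: over the quadric cone
`S_2 = ℂ[x]/(x₀₀x₁₁ + x₀₁x₁₀)` the rank-one matrix `adj Ā₂` is not an outer product), which is how
`3 ≤ n` enters the crux.

Typeclass note: Mathlib's `UniqueFactorizationMonoid R` (over `CommMonoidWithZero`) carries
`IsCancelMulZero R`, and `UniqueFactorizationMonoid.strongNormalizationMonoid` /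
`UniqueFactorizationMonoid.toStrongNormalizedGCDMonoid` equip `R` with a `StrongNormalizedGCDMonoid`
structure, so `Finset.gcd`, `Finset.extract_gcd` and `Finset.gcd_mul_left` are available without
assuming `IsDomain R` (the zero ring is covered by the case `B = 0`).
-/

noncomputable section

namespace Summit.ValiantsHypothesis.Theorems.RankOneTrivialisation

open Matrix

/-- **Primitive vectors clear denominators** (gcd form).  In a `StrongNormalizedGCDMonoid`, if
`a ∣ b * c i` for every `i ∈ s` and the `c i`, `i ∈ s`, have gcd `1`, then `a ∣ b`:
`a ∣ gcd_i (b * c i) = normalize b * gcd_i (c i) = normalize b`. [folklore] -/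
theorem dvd_of_dvd_mul_of_gcd_eq_one {R : Type*} [CommMonoidWithZero R] [StrongNormalizedGCDMonoid R]
    {ι : Type*} {s : Finset ι} {a b : R} {c : ι → R} (hgcd : s.gcd c = 1)
    (h : ∀ i ∈ s, a ∣ b * c i) : a ∣ b := by
  have h1 : a ∣ s.gcd fun i => b * c i := Finset.dvd_gcd h
  rwa [Finset.gcd_mul_left, hgcd, mul_one, dvd_normalize_iff] at h1

/-- **Stub 2 of line `nagata-multilinear-chart` (registered signature, verbatim): over a UFD a
rank-one matrix is an outer product.**  If all `2 × 2` minors of `B : Matrix (Fin m) (Fin m) R`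
vanish (`B i j * B k l = B i l * B k j`) over a unique factorisation monoid `R` (a commutative ring),
then `B i j = c i * w j` for some `c w : Fin m → R`.  Proof: gcd extraction of a non-zero column
(module docstring); `c` is the primitive part of that column, `w j = B k j / c k`. [folklore] -/
theorem stub_ufdOuterProduct :
    ∀ (R : Type) [CommRing R] [UniqueFactorizationMonoid R] (m : ℕ) (B : Matrix (Fin m) (Fin m) R),
      (∀ i j k l : Fin m, B i j * B k l = B i l * B k j) →
        ∃ c w : Fin m → R, ∀ i j, B i j = c i * w j := by
  intro R _ _ m B hB
  classical
  letI : StrongNormalizationMonoid R := UniqueFactorizationMonoid.strongNormalizationMonoid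
  letI : StrongNormalizedGCDMonoid R := UniqueFactorizationMonoid.toStrongNormalizedGCDMonoid R
  by_cases h0 : ∀ i j, B i j = 0
  · exact ⟨0, 0, fun i j => by rw [h0 i j, Pi.zero_apply, zero_mul]⟩
  push Not at h0
  obtain ⟨k, j₀, hk⟩ := h0
  -- the primitive part `c` of column `j₀`: `B i j₀ = g * c i`, `gcd c = 1`
  obtain ⟨c, hc, hcg⟩ :=
    Finset.extract_gcd (s := Finset.univ) (fun i => B i j₀) ⟨k, Finset.mem_univ k⟩
  set g : R := Finset.univ.gcd fun i => B i j₀ with hg_def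
  have hc' : ∀ i, B i j₀ = g * c i := fun i => hc i (Finset.mem_univ i)
  have hg0 : g ≠ 0 := by
    intro hg0
    apply hk
    rw [hc' k, hg0, zero_mul]
  have hck : c k ≠ 0 := by
    intro hck
    apply hk
    rw [hc' k, hck, mul_zero]
  -- the minor relations, with `g` cancelled: `c k * B i j = B k j * c i`
  have key : ∀ i j, c k * B i j = B k j * c i := by
    intro i j
    have h := hB i j k j₀
    rw [hc' k, hc' i] at h
    apply mul_left_cancel₀ hg0
    linear_combination h
  -- `c` is primitive, so `c k` divides row `k`
  have hdiv : ∀ j, c k ∣ B k j := fun j =>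
    dvd_of_dvd_mul_of_gcd_eq_one hcg fun i _ => ⟨B i j, (key i j).symm⟩
  choose w hw using hdiv
  refine ⟨c, w, fun i j => ?_⟩
  apply mul_left_cancel₀ hck
  rw [key i j, hw j]
  ring

end Summit.ValiantsHypothesis.Theorems.RankOneTrivialisation

end
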